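import Mathlib
import Literature.Analysis.ODE.ComplexSecondOrder

/-! # Helper B for the stub `stub_resolventExists` of the line `Sketch`
(crux stmt-AnomalousDissipation-3008, `MarginalStabilityChain.BurgersLayerKH`)

**Green's formula for `W'' = Q W − g` from an exponential dichotomy.** Given two global solutions
`W₊`, `W₋` of `W'' = Q W` (`Q, g : ℝ → ℂ`) with Wronskian `W₊ W₋' − W₊' W₋ ≡ 1`, the two-sided decay
`‖W₊ t‖ ≤ e^{−κ(t−s)} ‖W₊ s‖`, `‖W₋ s‖ ≤ e^{−κ(t−s)} ‖W₋ t‖` (`s ≤ t`, `κ > 0`) and the product bound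
`‖W₊ t‖ ‖W₋ t‖ ≤ P`, and a continuous forcing with `‖g‖ ≤ G`, the variation-of-parameters formula
`W(y) = W₊(y) ∫_{t ≤ y} W₋ g + W₋(y) ∫_{t > y} W₊ g`
is a `C²` solution of `W'' = Q W − g` on `ℝ` with `‖W‖ ≤ 2 G P / κ` (registered sub-goal
`green_bounded`). The two half-line primitives are handled by `leftTail` (integrability by
exponential domination, FTC, size `≤ B/κ`) and its reflection `rightTail`.
-/

set_option linter.dupNamespace false

noncomputable section

open Complex MeasureTheory Filter Topology Set Metric

namespace Summit.AnomalousDissipation.AnomalousDissipation.Theorems.BurgersLayerKH.Sheet.Resolvent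

open Literature.Analysis.ODE

/-! ## Half-line primitives of exponentially dominated continuous functions -/

/-- **Left tail.** If `f : ℝ → ℂ` is continuous and `‖f s‖ ≤ B(t) e^{−κ(t−s)}` for all `s ≤ t`
(`κ > 0`), then `f` is integrable on every `(−∞, t]`, `y ↦ ∫_{(−∞,y]} f` has derivative `f t` at
`t`, and `‖∫_{(−∞,t]} f‖ ≤ B(t)/κ`. [folklore] -/
theorem leftTail {f : ℝ → ℂ} {B : ℝ → ℝ} {κ : ℝ} (hκ : 0 < κ) (hf : Continuous f)
    (hb : ∀ t s : ℝ, s ≤ t → ‖f s‖ ≤ B t * Real.exp (-κ * (t - s))) (t : ℝ) :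
    IntegrableOn f (Iic t) ∧ HasDerivAt (fun y => ∫ s in Iic y, f s) (f t) t ∧
      ‖∫ s in Iic t, f s‖ ≤ B t / κ := by
  -- the dominating function on `(−∞, t]`
  have hdom : ∀ t, IntegrableOn (fun s => B t * Real.exp (-κ * t) * Real.exp (κ * s)) (Iic t) :=
    fun t => (integrableOn_exp_mul_Iic hκ t).const_mul _
  have hb' : ∀ t s : ℝ, s ≤ t → ‖f s‖ ≤ B t * Real.exp (-κ * t) * Real.exp (κ * s) := by
    intro t s hs
    refine (hb t s hs).trans_eq ?_
    rw [mul_assoc, ← Real.exp_add]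
    ring_nf
  have hint : ∀ t, IntegrableOn f (Iic t) := fun t =>
    Integrable.mono' (hdom t) hf.aestronglyMeasurable
      ((ae_restrict_iff' measurableSet_Iic).2 (Eventually.of_forall fun s hs => hb' t s hs))
  refine ⟨hint t, ?_, ?_⟩
  · have heq : (fun y => ∫ s in Iic y, f s) =
        fun y => (∫ s in Iic (t - 1), f s) + ∫ s in (t - 1)..y, f s := by
      funext y
      rw [← intervalIntegral.integral_Iic_sub_Iic (hint (t - 1)) (hint y)]
      ring
    rw [heq]
    exact (intervalIntegral.integral_hasDerivAt_right (hf.intervalIntegrable (t - 1) t)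
      (hf.stronglyMeasurableAtFilter _ _) hf.continuousAt).const_add _
  · calc ‖∫ s in Iic t, f s‖ ≤ ∫ s in Iic t, ‖f s‖ := norm_integral_le_integral_norm _
      _ ≤ ∫ s in Iic t, B t * Real.exp (-κ * t) * Real.exp (κ * s) :=
          setIntegral_mono_on (hint t).norm (hdom t) measurableSet_Iic fun s hs => hb' t s hs
      _ = B t / κ := by
          rw [MeasureTheory.integral_const_mul, integral_exp_mul_Iic hκ, mul_div_assoc', mul_assoc,
            ← Real.exp_add, show -κ * t + κ * t = 0 by ring, Real.exp_zero, mul_one]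

/-- **Right tail** (reflection of `leftTail`). If `f : ℝ → ℂ` is continuous and
`‖f s‖ ≤ B(t) e^{−κ(s−t)}` for all `t ≤ s` (`κ > 0`), then `y ↦ ∫_{(y,∞)} f` has derivative `−f t`
at `t` and `‖∫_{(t,∞)} f‖ ≤ B(t)/κ`. [folklore] -/
theorem rightTail {f : ℝ → ℂ} {B : ℝ → ℝ} {κ : ℝ} (hκ : 0 < κ) (hf : Continuous f)
    (hb : ∀ t s : ℝ, t ≤ s → ‖f s‖ ≤ B t * Real.exp (-κ * (s - t))) (t : ℝ) :
    HasDerivAt (fun y => ∫ s in Ioi y, f s) (-f t) t ∧ ‖∫ s in Ioi t, f s‖ ≤ B t / κ := by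
  have key : ∀ y : ℝ, ∫ s in Ioi y, f s = ∫ s in Iic (-y), f (-s) := fun y => by
    rw [integral_comp_neg_Iic]
    simp
  have h := leftTail (f := fun s => f (-s)) (B := fun t => B (-t)) hκ (hf.comp continuous_neg)
    (fun t s hst => by
      have := hb (-t) (-s) (neg_le_neg hst)
      rwa [show -κ * (-s - -t) = -κ * (t - s) by ring] at this)
  refine ⟨?_, ?_⟩
  · have h2 := ((h (-t)).2.1).scomp t (hasDerivAt_neg t)
    have hfun : (fun y => ∫ s in Ioi y, f s) = (fun y => ∫ s in Iic y, f (-s)) ∘ Neg.neg := by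
      funext y
      exact key y
    rw [hfun]
    simpa using h2
  · rw [key t]
    simpa using (h (-t)).2.2

/-! ## Green's formula -/

/-- **Bounded solution of `W'' = Q W − g` by variation of parameters** (registered sub-goal of
`stub_resolventExists`): with global solutions `W₊, W₋` of the homogeneous equation of Wronskian `1`,
two-sided exponential decay at rate `κ > 0` and product bound `‖W₊‖‖W₋‖ ≤ P`, and continuous `g` with
`‖g‖ ≤ G`, the function `W = W₊ ∫_{≤ y} W₋ g + W₋ ∫_{> y} W₊ g` is twice differentiable,
`W'' = Q W − g`, and `‖W‖ ≤ 2 G P/κ`. [folklore] -/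
theorem green_bounded : ∀ (Q g Wp Wp' Wm Wm' : ℝ → ℂ) (κ P G : ℝ), Continuous g → 0 < κ → (∀ t : ℝ, ‖g t‖ ≤ G) → Literature.Analysis.ODE.IsSol2 Q Wp Wp' Set.univ → Literature.Analysis.ODE.IsSol2 Q Wm Wm' Set.univ → (∀ t : ℝ, Literature.Analysis.ODE.wronskian Wp Wp' Wm Wm' t = 1) → (∀ s t : ℝ, s ≤ t → ‖Wp t‖ ≤ Real.exp (-κ * (t - s)) * ‖Wp s‖) → (∀ s t : ℝ, s ≤ t → ‖Wm s‖ ≤ Real.exp (-κ * (t - s)) * ‖Wm t‖) → (∀ t : ℝ, ‖Wp t‖ * ‖Wm t‖ ≤ P) → ∃ W W' : ℝ → ℂ, (∀ t : ℝ, HasDerivAt W (W' t) t) ∧ (∀ t : ℝ, HasDerivAt W' (Q t * W t - g t) t) ∧ ∀ t : ℝ, ‖W t‖ ≤ 2 * G * P / κ := by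
  intro Q g Wp Wp' Wm Wm' κ P G hg hκ hG hp hm hW hdp hdm hP
  have hG0 : 0 ≤ G := (norm_nonneg _).trans (hG 0)
  have cp : Continuous Wp := continuous_iff_continuousAt.2 fun t => (hp.hasDerivAt t (mem_univ _)).continuousAt
  have cm : Continuous Wm := continuous_iff_continuousAt.2 fun t => (hm.hasDerivAt t (mem_univ _)).continuousAt
  -- the two primitives
  have h1 : ∀ t, HasDerivAt (fun y => ∫ s in Iic y, Wm s * g s) (Wm t * g t) t ∧
      ‖∫ s in Iic t, Wm s * g s‖ ≤ G * ‖Wm t‖ / κ := fun t => by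
    have h := leftTail (f := fun s => Wm s * g s) (B := fun t => G * ‖Wm t‖) hκ (cm.mul hg)
      (fun t s hst => by
        rw [norm_mul]
        calc ‖Wm s‖ * ‖g s‖ ≤ Real.exp (-κ * (t - s)) * ‖Wm t‖ * G :=
              mul_le_mul (hdm s t hst) (hG s) (norm_nonneg _) (by positivity)
          _ = G * ‖Wm t‖ * Real.exp (-κ * (t - s)) := by ring) t
    exact ⟨h.2.1, h.2.2⟩
  have h2 : ∀ t, HasDerivAt (fun y => ∫ s in Ioi y, Wp s * g s) (-(Wp t * g t)) t ∧
      ‖∫ s in Ioi t, Wp s * g s‖ ≤ G * ‖Wp t‖ / κ := fun t =>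
    rightTail (f := fun s => Wp s * g s) (B := fun t => G * ‖Wp t‖) hκ (cp.mul hg)
      (fun t s hts => by
        rw [norm_mul]
        calc ‖Wp s‖ * ‖g s‖ ≤ Real.exp (-κ * (s - t)) * ‖Wp t‖ * G :=
              mul_le_mul (hdp t s hts) (hG s) (norm_nonneg _) (by positivity)
          _ = G * ‖Wp t‖ * Real.exp (-κ * (s - t)) := by ring) t
  set I₁ : ℝ → ℂ := fun y => ∫ s in Iic y, Wm s * g s with hI₁
  set I₂ : ℝ → ℂ := fun y => ∫ s in Ioi y, Wp s * g s with hI₂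
  refine ⟨fun y => Wp y * I₁ y + Wm y * I₂ y, fun y => Wp' y * I₁ y + Wm' y * I₂ y,
    fun t => ?_, fun t => ?_, fun t => ?_⟩
  · have h := ((hp.hasDerivAt t (mem_univ _)).mul (h1 t).1).add
      ((hm.hasDerivAt t (mem_univ _)).mul (h2 t).1)
    refine h.congr_deriv ?_
    simp only [hI₁, hI₂]
    ring
  · have h := ((hp.hasDerivAt_deriv t (mem_univ _)).mul (h1 t).1).add
      ((hm.hasDerivAt_deriv t (mem_univ _)).mul (h2 t).1)
    refine h.congr_deriv ?_
    have hw := hW t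
    unfold wronskian at hw
    simp only [hI₁, hI₂]
    linear_combination -(g t) * hw
  · have hb1 := (h1 t).2
    have hb2 := (h2 t).2
    simp only [hI₁, hI₂]
    calc ‖Wp t * (∫ s in Iic t, Wm s * g s) + Wm t * ∫ s in Ioi t, Wp s * g s‖
        ≤ ‖Wp t‖ * ‖∫ s in Iic t, Wm s * g s‖ + ‖Wm t‖ * ‖∫ s in Ioi t, Wp s * g s‖ := by
          refine (norm_add_le _ _).trans ?_
          rw [norm_mul, norm_mul]
      _ ≤ ‖Wp t‖ * (G * ‖Wm t‖ / κ) + ‖Wm t‖ * (G * ‖Wp t‖ / κ) := by gcongr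
      _ = 2 * G * (‖Wp t‖ * ‖Wm t‖) / κ := by ring
      _ ≤ 2 * G * P / κ := by gcongr; exact hP t

end Summit.AnomalousDissipation.AnomalousDissipation.Theorems.BurgersLayerKH.Sheet.Resolvent

end
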